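import Summits.Schanuel.Schanuel.Theorems.DiophantineDichotomyEPiRaceEv
import Literature.NumberTheory.Transcendental.PeriodsWave0

/-!
# `EPiSimultaneousType` contains `e ⊥ π` — strength certificate for item stmt-Schanuel-6118

Route `Schanuel/DiophantineDichotomy`, support item stmt-Schanuel-6118
(`Summit.Schanuel.Schanuel.Theses.DiophantineDichotomy.EPiSimultaneousType`: a simultaneous
approximation measure `‖γ − (π, e)‖ ≥ exp(−C(dᵃ log H + dᵇ))` with degree exponent `a < 1` for all
algebraic challengers `γ` of joint degree `≤ d` and naive height `≤ H`).

This file kernel-checks, BY NAME, why the item is classed `open-problem`: together with the level-one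
approximation property `ApproximationPropertyDegOne` (item stmt-Schanuel-11037 — a KNOWN theorem,
Laurent–Roy 1999 Thm 1 / Diaz 1997 = Bugeaud 2004 Thm 8.11, the latter discharged in the tree as
`Literature.NumberTheory.DiophantineApproximation.Bugeaud2004_thm_8_11_holds`) the item implies the
tree's OPEN conjecture `Literature.NumberTheory.Transcendental.ExpOnePiAlgebraicIndependent`
(`AlgebraicIndependent ℚ ![Real.exp 1, Real.pi]`, `@[conjecture]`, `PeriodsWave0`), and so does its
eventual-in-the-height weakening `EPiSimultaneousTypeEv` (item stmt-Schanuel-14975).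

* `EPiSimultaneousType.levelOneAP_pi_e_of_degOne` — `ApproximationPropertyDegOne` specialises verbatim
  (`ι = Fin 2`, `θ = ![π, e]`) to the hypothesis of the PROVED races `EPiRace` / `EPiRaceEv`.
* `expOnePiAlgebraicIndependent_of_degOne_of_epiSimultaneousType` —
  `ApproximationPropertyDegOne → EPiSimultaneousType → ExpOnePiAlgebraicIndependent` (via `ePiRace_proof`).
* `expOnePiAlgebraicIndependent_of_degOne_of_epiSimultaneousTypeEv` — the same from the eventual form
  (via `ePiRaceEv_proof`).

So any proof of the item proves the algebraic independence of `e` and `π` (with a measure); no such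
measure is in print (grounder g18-9, disprover `Cruxes/EPiSimultaneousType/Disproof.lean` v1–v3).
Nothing is asserted unconditionally about `e ⊥ π`; all theorems are implications. No `def`.
-/

-- `Summit.Schanuel.Schanuel.…` is the mandated summit/sub-problem namespace (single-conjunct summit), hence:
set_option linter.dupNamespace false

namespace Summit.Schanuel.Schanuel.Theorems

open Summit.Schanuel.Schanuel.Theses.DiophantineDichotomy

namespace EPiSimultaneousType

/-- The level-one approximation property `ApproximationPropertyDegOne` (item stmt-Schanuel-11037),
specialised to `ι = Fin 2`, `θ = (π, e)`, is verbatim the Diophantine hypothesis of the races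
`EPiRace` / `EPiRaceEv`. [folklore] -/
theorem levelOneAP_pi_e_of_degOne (hAP : ApproximationPropertyDegOne) :
    Algebra.trdeg ℚ ↥(IntermediateField.adjoin ℚ (Set.range ![(Real.pi : ℂ), (Real.exp 1 : ℂ)]))
        ≤ (1 : Cardinal) →
      ∃ c : ℝ, 1 ≤ c ∧ ∀ Δ Y : ℝ, c ≤ Δ → Δ ≤ Y → ∃ (γ : Fin 2 → ℂ) (d H : ℕ),
        Module.finrank ℚ ↥(IntermediateField.adjoin ℚ (Set.range γ)) ≤ d ∧
        (∀ i, ∃ P : Polynomial ℤ, P ≠ 0 ∧ P.natDegree ≤ d ∧ (∀ k, |P.coeff k| ≤ (H : ℤ)) ∧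
          Polynomial.aeval (γ i) P = 0) ∧
        (d : ℝ) ≤ c * Δ ∧ Real.log H ≤ c * Y ∧
        ‖γ - ![(Real.pi : ℂ), (Real.exp 1 : ℂ)]‖ ≤ Real.exp (-((Real.log H * Δ + d * Y) / c)) :=
  hAP (Fin 2) ![(Real.pi : ℂ), (Real.exp 1 : ℂ)]

end EPiSimultaneousType

/-- **Item stmt-Schanuel-6118 contains `e ⊥ π`.** The level-one approximation property
(`ApproximationPropertyDegOne`, known: Laurent–Roy 1999 / Bugeaud 2004 Thm 8.11) and the
simultaneous approximation measure `EPiSimultaneousType` (degree exponent `a < 1`) give the open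
conjecture `ExpOnePiAlgebraicIndependent` — by the proved race `ePiRace_proof` at the specialised
hypothesis. [folklore] -/
theorem expOnePiAlgebraicIndependent_of_degOne_of_epiSimultaneousType :
    ApproximationPropertyDegOne → EPiSimultaneousType →
      Literature.NumberTheory.Transcendental.ExpOnePiAlgebraicIndependent :=
  fun hAP h => ePiRace_proof (EPiSimultaneousType.levelOneAP_pi_e_of_degOne hAP) h

/-- **The eventual form (item stmt-Schanuel-14975) also contains `e ⊥ π`.** The level-one
approximation property and the EVENTUAL simultaneous approximation measure `EPiSimultaneousTypeEv`
(heights `H ≥ H₀(d)` only) give `ExpOnePiAlgebraicIndependent` — by the proved eventual race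
`ePiRaceEv_proof` (race compactness at `t = 1`). [folklore] -/
theorem expOnePiAlgebraicIndependent_of_degOne_of_epiSimultaneousTypeEv :
    ApproximationPropertyDegOne → EPiSimultaneousTypeEv →
      Literature.NumberTheory.Transcendental.ExpOnePiAlgebraicIndependent :=
  fun hAP h => ePiRaceEv_proof (EPiSimultaneousType.levelOneAP_pi_e_of_degOne hAP) h

end Summit.Schanuel.Schanuel.Theorems
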